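import Literature.NumberTheory.Automorphic.UnitaryGroupRayJacquetCriterion
import HarnessLib

/-!
# Harish-Chandra's criterion ⇐ for `U(σ, Φ_N)(K)` along a contracting diagonal ray — ANY RANK `N`, any quadratic involution `σ`

THEOREMS ONLY (no `def`, no `instance`, no notation, no named fact, no `sorry`; axioms ⊆ {propext, Classical.choice, Quot.sound}).
`K` is a non-archimedean local field, `σ` a continuous involution of `K`, `U = U(σ, Φ_N)(K) = unitaryGroupOfForm σ J` with `J = Φ_N`
antidiagonal, `B = T N` the upper-triangular Borel (★ `borelTriple σ J hJ`, any `N`), `K₀ = U ∩ GL_N(𝒪) = (glInt N K).comap U.subtype`,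
`K_γ = congruenceGL N γ`.

THE POINT.  ★ `UnitaryGroupRayJacquetCriterion` (p830719) runs Casselman's contraction argument for `U(σ, Φ₃)(K)` with the size pinned to
`Fin 3`; its mathematics is rank-free.  This file is the SAME argument at an arbitrary rank `N` (§1–§2, proofs transported verbatim, the
`3`s replaced by `N`), so that the quasi-split unitary group in TWO variables `U(σ, Φ₂)(K)` — the group of the CM crux line (N-H-ii′) of
`H413` (cell `pub/hodgecm-mathlib`, ★ `F0P3bU2PrincipalSeriesHCOfJacquetCriterion.hHC_of_jacquetVanishing_supercuspidal_two`) — is served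
too (§3: the ray `a = d(ϖ, (σϖ)⁻¹)`).  The engine is the tree's GENERIC ★ `Representation.isSupercuspidal_of_subsingleton_coinvariants_of_cartan`
(`JacquetCuspidalCompactCoefficients`): a level filtration `N_j` of `N` (increasing, exhausting, shrinking to `1`, contracted by `t`), a compact
`K₀`, and the Cartan decomposition `U = ⋃_n K₀ tⁿ K₀ Z(U)` — the latter stays a HYPOTHESIS (`hcartan`); for `N = 3` it is ★
`exists_cartan_of_involution`, for `N = 2` it is not yet in the tree.

## Contents (namespace `Literature.NumberTheory.Automorphic.UnitaryGroup.AnyRank`, names as in the rank-3 file)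
* §1 (algebra, any field with a `ValuativeRel`) `diag_conj_mem_comap_congruenceGL_inf_N` ∕ `diag_conj_mem_of_mem` (conjugation by a diagonal
  element of `U` with small ratios CONTRACTS `K_γ ∩ N`), `coe_pow_eq_glDiagonal_pow`, `valuation_pow_ratio_le`, `rayLevel_mono`, `conj_mem_rayLevel`.
* §2 (`K` a non-archimedean local field) `isCompact_comap_glInt` (`K₀` compact, any `N`), `exists_mem_rayLevel`, `exists_rayLevel_subset`, and
  **`isSupercuspidal_of_coinvariants_subsingleton_of_rayCartan`** (abstract contracting ray `t = diag(w)`, `|w_i ∕ w_j| ≤ q < 1` for `i < j`).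
* §3 `N = 2`: **`isSupercuspidal_of_coinvariants_subsingleton_of_cartan_diagonal_two`** — ray pinned by `ha : (a : matrix) = diagonal ![ϖ, (σ ϖ)⁻¹]`
  (`0 < |ϖ| < 1`, `|σ x| = |x|`): smooth `ρ`, `V_N(ρ) = 0`, `hcartan` ⇒ `ρ` supercuspidal.

HONEST SCOPE: nothing is discharged by this file alone; with a Cartan decomposition of `U(σ, Φ₂)(K)` for an arbitrary involution it yields
Harish-Chandra's criterion ⇐ for `U(Φ₂)` at every non-split place.  HC_CM is proved only modulo the printed citations until rung 0 closes.

## References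
* [Casselman1995] W. Casselman, *Introduction to the theory of admissible representations of `p`-adic reductive groups* (1995 notes),
  Prop. 1.4.4, Thm. 5.3.1.
* [BernsteinZelevinsky1976] I. N. Bernstein, A. V. Zelevinsky, *Representations of the group GL(n, F) where F is a non-archimedean local
  field*, Russian Math. Surveys 31:3 (1976), §3.18–3.21, Thm. 3.21.
* [BernsteinZelevinsky1977] I. N. Bernstein, A. V. Zelevinsky, *Induced representations of reductive p-adic groups I*, Ann. Sci. ÉNS 10
  (1977), §1.8–1.9.
* [HarishChandra1970] Harish-Chandra (notes by G. van Dijk), *Harmonic analysis on reductive p-adic groups*, LNM 162 (1970), Part I §3.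
* [PlatonovRapinchuk1994] V. Platonov, A. Rapinchuk, *Algebraic Groups and Number Theory* (1994), §3.3.
-/

set_option autoImplicit false

open scoped MatrixGroups Pointwise Topology
open ValuativeRel Matrix

namespace Literature.NumberTheory.Automorphic

namespace UnitaryGroup

namespace AnyRank

/-! ## §1 Conjugating `K_γ ∩ N` by a diagonal element of `U` whose diagonal ratios are small (any rank) -/

section RayAlg

variable {K : Type*} [Field K] [ValuativeRel K] (σ : K →+* K) {N : ℕ} {J : Matrix (Fin N) (Fin N) K}
  (hJ : J = (StdForm.antidiagonal N).over K)

/-- **Conjugation by a diagonal element of `U` with small diagonal ratios contracts the unipotent radical into a principal congruence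
subgroup** (any rank): if `s = diag(u) ∈ U`, `|u_i / u_j| ≤ q'` for `i < j`, and `x ∈ N` has `q' · |(x - 1)_{ij}| ≤ γ' < 1` above the diagonal,
then `s x s⁻¹ ∈ K_{γ'} ∩ N`. [cite: Casselman1995, Prop. 1.4.4; proof of Thm. 5.3.1] [cite: BernsteinZelevinsky1976, §3.18–3.21] -/
theorem diag_conj_mem_comap_congruenceGL_inf_N {q' γ' : ValueGroupWithZero K} (hγ' : γ' < 1) (s : ↥(unitaryGroupOfForm σ J)) (u : Fin N → Kˣ)
    (hs : ((s : ↥(unitaryGroupOfForm σ J)) : GL (Fin N) K) = glDiagonal N K u) (hu : ∀ i j : Fin N, i < j → valuation K ((u i : K) * ((u j : K))⁻¹) ≤ q')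
    {x : ↥(unitaryGroupOfForm σ J)} (hxN : x ∈ (borelTriple σ J hJ).N)
    (hxb : ∀ i j : Fin N, i < j → q' * valuation K (((((x : ↥(unitaryGroupOfForm σ J)) : GL (Fin N) K) : Matrix (Fin N) (Fin N) K) - 1) i j) ≤ γ') :
    s * x * s⁻¹ ∈ (congruenceGL N γ').comap (unitaryGroupOfForm σ J).subtype ⊓ (borelTriple σ J hJ).N := by
  have hxN' : ((x : ↥(unitaryGroupOfForm σ J)) : GL (Fin N) K) ∈ upperUnitriangular (Fin N) K := hxN
  obtain ⟨htri, hdiag⟩ := (mem_upperUnitriangular_iff _).1 hxN'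
  refine Subgroup.mem_inf.2 ⟨?_, ?_⟩
  · show (((s * x * s⁻¹ : ↥(unitaryGroupOfForm σ J))) : GL (Fin N) K) ∈ congruenceGL N γ'
    rw [Subgroup.coe_mul, Subgroup.coe_mul, Subgroup.coe_inv, hs]
    refine mem_congruenceGL_of_valBound_sub_one hγ' fun i j => ?_
    rw [coe_glDiagonal_mul_mul_inv_sub_one_apply, map_mul]
    rcases lt_or_ge i j with hij | hij
    · exact le_trans (mul_le_mul' (hu i j hij) le_rfl) (hxb i j hij)
    · have h0 : ((((x : ↥(unitaryGroupOfForm σ J)) : GL (Fin N) K) : Matrix (Fin N) (Fin N) K) - 1) i j = 0 := by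
        rw [Matrix.sub_apply]
        rcases lt_or_eq_of_le hij with hlt | heq
        · rw [htri hlt, Matrix.one_apply_ne (ne_of_gt hlt), sub_zero]
        · rw [heq, hdiag, Matrix.one_apply_eq, sub_self]
      rw [h0, map_zero, mul_zero]
      exact zero_le
  · exact (borelTriple σ J hJ).normal_subgroupOf.conj_mem ⟨x, (borelTriple σ J hJ).N_le hxN⟩ hxN
      ⟨s, (borelTriple σ J hJ).M_le (by rw [borelTriple_M, mem_torusU_iff]; exact ⟨u, hs.symm⟩)⟩

/-- The special case `x ∈ K_γ ∩ N`, `q' γ ≤ γ' < 1`: `s (K_γ ∩ N) s⁻¹ ⊆ K_{γ'} ∩ N` (any rank). [cite: Casselman1995, Prop. 1.4.4] -/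
theorem diag_conj_mem_of_mem {q' γ γ' : ValueGroupWithZero K} (hγ' : γ' < 1) (hqγ : q' * γ ≤ γ') (s : ↥(unitaryGroupOfForm σ J)) (u : Fin N → Kˣ)
    (hs : ((s : ↥(unitaryGroupOfForm σ J)) : GL (Fin N) K) = glDiagonal N K u) (hu : ∀ i j : Fin N, i < j → valuation K ((u i : K) * ((u j : K))⁻¹) ≤ q')
    {x : ↥(unitaryGroupOfForm σ J)} (hx : x ∈ (congruenceGL N γ).comap (unitaryGroupOfForm σ J).subtype ⊓ (borelTriple σ J hJ).N) :
    s * x * s⁻¹ ∈ (congruenceGL N γ').comap (unitaryGroupOfForm σ J).subtype ⊓ (borelTriple σ J hJ).N := by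
  obtain ⟨hxK, hxN⟩ := Subgroup.mem_inf.1 hx
  exact diag_conj_mem_comap_congruenceGL_inf_N σ hJ hγ' s u hs hu hxN fun i j _ =>
    le_trans (mul_le_mul' le_rfl (((mem_congruenceGL_iff.1 hxK).2.1) i j)) hqγ

omit [ValuativeRel K] in
/-- Powers of a diagonal element of `U`: `(diag(w))^m = diag(w^m)` (any rank). [cite: Casselman1995, proof of Thm. 5.3.1] -/
theorem coe_pow_eq_glDiagonal_pow (t : ↥(unitaryGroupOfForm σ J)) (w : Fin N → Kˣ) (ht : ((t : ↥(unitaryGroupOfForm σ J)) : GL (Fin N) K) = glDiagonal N K w) (m : ℕ) :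
    ((t ^ m : ↥(unitaryGroupOfForm σ J)) : GL (Fin N) K) = glDiagonal N K (w ^ m) := by
  rw [Subgroup.coe_pow, ht, map_pow]

omit [ValuativeRel K] in
/-- Diagonal ratios of `w^m` are the `m`-th powers of those of `w`: `|w_i^m / w_j^m| ≤ q^m` (any rank; any valuation-like bound is monotone
under powers). [cite: Casselman1995, proof of Thm. 5.3.1] -/
theorem valuation_pow_ratio_le [ValuativeRel K] {q : ValueGroupWithZero K} (w : Fin N → Kˣ)
    (hw : ∀ i j : Fin N, i < j → valuation K ((w i : K) * ((w j : K))⁻¹) ≤ q) (m : ℕ) :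
    ∀ i j : Fin N, i < j → valuation K (((w ^ m) i : K) * (((w ^ m) j : K))⁻¹) ≤ q ^ m := by
  intro i j hij
  rw [Pi.pow_apply, Pi.pow_apply, Units.val_pow_eq_pow_val, Units.val_pow_eq_pow_val, ← inv_pow, ← mul_pow, map_pow]
  exact pow_le_pow_left₀ zero_le (hw i j hij) m

/-- **The ray levels increase** (any rank): `t^{-j}(K_γ ∩ N)t^{j} ≤ t^{-(j+1)}(K_γ ∩ N)t^{j+1}` — conjugation by `t` contracts `K_γ ∩ N`
(`q γ ≤ γ`). [cite: BernsteinZelevinsky1976, §3.18–3.21] [cite: Casselman1995, Prop. 1.4.4] -/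
theorem rayLevel_mono {q : ValueGroupWithZero K} (hq1 : q < 1) {γ : ValueGroupWithZero K} (hγ : γ < 1) (t : ↥(unitaryGroupOfForm σ J)) (w : Fin N → Kˣ)
    (ht : ((t : ↥(unitaryGroupOfForm σ J)) : GL (Fin N) K) = glDiagonal N K w) (hw : ∀ i j : Fin N, i < j → valuation K ((w i : K) * ((w j : K))⁻¹) ≤ q)
    (j : ℤ) :
    ((congruenceGL N γ).comap (unitaryGroupOfForm σ J).subtype ⊓ (borelTriple σ J hJ).N).map (MulAut.conj (t ^ (-j))).toMonoidHom ≤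
      ((congruenceGL N γ).comap (unitaryGroupOfForm σ J).subtype ⊓ (borelTriple σ J hJ).N).map (MulAut.conj (t ^ (-(j + 1)))).toMonoidHom := by
  intro y hy
  rw [mem_map_conj_zpow_neg_iff] at hy ⊢
  have hre : t ^ (j + 1) * y * t ^ (-(j + 1)) = t * (t ^ j * y * t ^ (-j)) * t⁻¹ := by group
  rw [hre]
  exact diag_conj_mem_of_mem σ hJ hγ (le_trans (mul_le_mul' hq1.le le_rfl) (one_mul γ).le) t w ht hw hy

/-- **`t` contracts the ray levels** (any rank): `u ∈ t^{-(j+1)}(K_γ ∩ N)t^{j+1} ⇒ t u t⁻¹ ∈ t^{-j}(K_γ ∩ N)t^{j}`.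
[cite: BernsteinZelevinsky1976, §3.18–3.21] -/
theorem conj_mem_rayLevel {γ : ValueGroupWithZero K} (t : ↥(unitaryGroupOfForm σ J)) (j : ℤ) {u : ↥(unitaryGroupOfForm σ J)}
    (hu : u ∈ ((congruenceGL N γ).comap (unitaryGroupOfForm σ J).subtype ⊓ (borelTriple σ J hJ).N).map (MulAut.conj (t ^ (-(j + 1)))).toMonoidHom) :
    t * u * t⁻¹ ∈ ((congruenceGL N γ).comap (unitaryGroupOfForm σ J).subtype ⊓ (borelTriple σ J hJ).N).map (MulAut.conj (t ^ (-j))).toMonoidHom := by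
  rw [mem_map_conj_zpow_neg_iff] at hu ⊢
  have hre : t ^ j * (t * u * t⁻¹) * t ^ (-j) = t ^ (j + 1) * u * t ^ (-(j + 1)) := by group
  rw [hre]
  exact hu

end RayAlg

/-! ## §2 Compactness of `K₀`, exhaustion and smallness of the ray levels; the criterion (any rank) -/

section RayTop

variable {K : Type*} [Field K] [ValuativeRel K] [TopologicalSpace K] [IsNonarchimedeanLocalField K]
  (σ : K →+* K) {N : ℕ} {J : Matrix (Fin N) (Fin N) K} (hJ : J = (StdForm.antidiagonal N).over K)
  {V : Type*} [AddCommGroup V] [Module ℂ V]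

/-- `K₀ = U ∩ GL_N(𝒪)` is compact (closed embedding `U ↪ GL_N(K)` ★ `isClosed_unitaryGroupOfForm`, ★ `isCompact_glInt`), any rank.
[cite: PlatonovRapinchuk1994, §3.3] -/
theorem isCompact_comap_glInt (hσc : Continuous σ) :
    IsCompact (((glInt N K).comap (unitaryGroupOfForm σ J).subtype : Subgroup ↥(unitaryGroupOfForm σ J)) : Set ↥(unitaryGroupOfForm σ J)) := by
  haveI : T2Space K := (Literature.NumberTheory.GaloisRepresentations.IsNonarchimedeanLocalField.isLocalField K).toT2Space
  exact (isClosed_unitaryGroupOfForm hσc J).isClosedEmbedding_subtypeVal.isCompact_preimage (isCompact_glInt N K)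

/-- **The ray levels exhaust `N`** (any rank): every `u ∈ N` lies in `t^{-m}(K_γ ∩ N)t^{m}` for `m` large (`0 < q < 1`, `γ ≠ 0`).
[cite: BernsteinZelevinsky1977, §1.9] [cite: Casselman1995, proof of Thm. 5.3.1] -/
theorem exists_mem_rayLevel {q : ValueGroupWithZero K} (hq0 : q ≠ 0) (hq1 : q < 1) {γ : ValueGroupWithZero K} (hγ0 : γ ≠ 0) (hγ : γ < 1)
    (t : ↥(unitaryGroupOfForm σ J)) (w : Fin N → Kˣ) (ht : ((t : ↥(unitaryGroupOfForm σ J)) : GL (Fin N) K) = glDiagonal N K w)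
    (hw : ∀ i j : Fin N, i < j → valuation K ((w i : K) * ((w j : K))⁻¹) ≤ q) {u : ↥(unitaryGroupOfForm σ J)} (hu : u ∈ (borelTriple σ J hJ).N) :
    ∃ j : ℤ, u ∈ ((congruenceGL N γ).comap (unitaryGroupOfForm σ J).subtype ⊓ (borelTriple σ J hJ).N).map (MulAut.conj (t ^ (-j))).toMonoidHom := by
  classical
  obtain ⟨Γ, hΓ⟩ : ∃ Γ : ValueGroupWithZero K, ∀ i j,
      valuation K (((((u : ↥(unitaryGroupOfForm σ J)) : GL (Fin N) K) : Matrix (Fin N) (Fin N) K) - 1) i j) ≤ Γ :=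
    ⟨Finset.univ.sup fun p : Fin N × Fin N => valuation K (((((u : ↥(unitaryGroupOfForm σ J)) : GL (Fin N) K) : Matrix (Fin N) (Fin N) K) - 1) p.1 p.2),
      fun i j => Finset.le_sup (f := fun p : Fin N × Fin N =>
        valuation K (((((u : ↥(unitaryGroupOfForm σ J)) : GL (Fin N) K) : Matrix (Fin N) (Fin N) K) - 1) p.1 p.2)) (Finset.mem_univ (i, j))⟩
  obtain ⟨m, hm⟩ := exists_pow_mul_le hq0 hq1 Γ hγ0
  refine ⟨(m : ℤ), ?_⟩
  rw [mem_map_conj_zpow_neg_iff, _root_.zpow_neg, zpow_natCast]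
  exact diag_conj_mem_comap_congruenceGL_inf_N σ hJ hγ (t ^ m) (w ^ m) (coe_pow_eq_glDiagonal_pow σ t w ht m)
    (valuation_pow_ratio_le w hw m) hu fun i j _ => le_trans (mul_le_mul' le_rfl (hΓ i j)) hm

/-- **The ray levels shrink to `1`** (any rank): every neighbourhood of `1` in `U` contains `t^{m}(K_γ ∩ N)t^{-m}` for `m` large — `U` carries
the subspace topology of `GL_N(K)`, in which the `K_{γ'}` form a basis of neighbourhoods of `1` (★ `exists_congruenceGL_subset`).
[cite: BernsteinZelevinsky1976, §3.18–3.21] [cite: Casselman1995, Prop. 1.4.4] -/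
theorem exists_rayLevel_subset {q : ValueGroupWithZero K} (hq0 : q ≠ 0) (hq1 : q < 1) {γ : ValueGroupWithZero K} (hγ0 : γ ≠ 0) (hγ : γ < 1)
    (t : ↥(unitaryGroupOfForm σ J)) (w : Fin N → Kˣ) (ht : ((t : ↥(unitaryGroupOfForm σ J)) : GL (Fin N) K) = glDiagonal N K w)
    (hw : ∀ i j : Fin N, i < j → valuation K ((w i : K) * ((w j : K))⁻¹) ≤ q) {O : Set ↥(unitaryGroupOfForm σ J)} (hO : O ∈ 𝓝 (1 : ↥(unitaryGroupOfForm σ J))) :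
    ∃ j : ℤ, ((((congruenceGL N γ).comap (unitaryGroupOfForm σ J).subtype ⊓ (borelTriple σ J hJ).N).map (MulAut.conj (t ^ (-j))).toMonoidHom :
      Subgroup ↥(unitaryGroupOfForm σ J)) : Set ↥(unitaryGroupOfForm σ J)) ⊆ O := by
  obtain ⟨O', hO', hsub⟩ := (mem_nhds_induced Subtype.val (1 : ↥(unitaryGroupOfForm σ J)) O).1 hO
  rw [Subgroup.coe_one] at hO'
  obtain ⟨δ, hδ⟩ := exists_congruenceGL_subset hO'
  have hγ₁0 : min (δ : ValueGroupWithZero K) γ ≠ 0 := by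
    rcases min_choice (δ : ValueGroupWithZero K) γ with h | h
    · rw [h]; exact Units.ne_zero δ
    · rw [h]; exact hγ0
  have hγ₁ : min (δ : ValueGroupWithZero K) γ < 1 := lt_of_le_of_lt (min_le_right _ _) hγ
  obtain ⟨m, hm⟩ := exists_pow_mul_le hq0 hq1 γ hγ₁0
  refine ⟨-(m : ℤ), fun y hy => ?_⟩
  have hy' : t ^ (-(m : ℤ)) * y * t ^ (-(-(m : ℤ))) ∈ ((congruenceGL N γ).comap (unitaryGroupOfForm σ J).subtype ⊓ (borelTriple σ J hJ).N) :=
    (mem_map_conj_zpow_neg_iff _ t _ y).1 hy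
  have hre : y = t ^ m * (t ^ (-(m : ℤ)) * y * t ^ (-(-(m : ℤ)))) * (t ^ m)⁻¹ := by
    rw [neg_neg, _root_.zpow_neg, zpow_natCast]; group
  have hmem := diag_conj_mem_of_mem σ hJ hγ₁ hm (t ^ m) (w ^ m) (coe_pow_eq_glDiagonal_pow σ t w ht m)
    (valuation_pow_ratio_le w hw m) hy'
  rw [← hre] at hmem
  refine hsub ?_
  show ((y : ↥(unitaryGroupOfForm σ J)) : GL (Fin N) K) ∈ O'
  exact hδ (congruenceGL_mono (min_le_left _ _) (Subgroup.mem_inf.1 hmem).1)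

/-- **HARISH-CHANDRA'S CRITERION ⇐ FOR `U(σ, Φ_N)(K)` ALONG A CONTRACTING DIAGONAL RAY** (any rank `N`, any continuous quadratic `σ`).
Let `t = diag(w) ∈ U` have small diagonal ratios (`|w_i/w_j| ≤ q < 1` for `i < j`), `K₀ = U ∩ GL_N(𝒪)`, and suppose the CARTAN
DECOMPOSITION `U = ⋃_n K₀ tⁿ K₀ Z(U)`.  Then a smooth representation of `U` whose Jacquet module along the Borel vanishes is supercuspidal:
the tree's generic ★ `Representation.isSupercuspidal_of_subsingleton_coinvariants_of_cartan` fed with the ray levels `N_j = t^{-j}(K_q ∩ N)t^{j}`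
(§1–§2) and `isCompact_comap_glInt`. [cite: Casselman1995, Thm. 5.3.1] [cite: BernsteinZelevinsky1976, Thm. 3.21] [cite: HarishChandra1970, Part I §3] -/
theorem isSupercuspidal_of_coinvariants_subsingleton_of_rayCartan (hσc : Continuous σ) {q : ValueGroupWithZero K} (hq0 : q ≠ 0)
    (hq1 : q < 1) (t : ↥(unitaryGroupOfForm σ J)) (w : Fin N → Kˣ) (ht : ((t : ↥(unitaryGroupOfForm σ J)) : GL (Fin N) K) = glDiagonal N K w)
    (hw : ∀ i j : Fin N, i < j → valuation K ((w i : K) * ((w j : K))⁻¹) ≤ q)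
    (hcartan : ∀ g : ↥(unitaryGroupOfForm σ J), ∃ k₁ ∈ (glInt N K).comap (unitaryGroupOfForm σ J).subtype,
      ∃ k₂ ∈ (glInt N K).comap (unitaryGroupOfForm σ J).subtype, ∃ n : ℕ, ∃ z ∈ Subgroup.center ↥(unitaryGroupOfForm σ J), g = k₁ * t ^ n * k₂ * z)
    (ρ : Representation ℂ ↥(unitaryGroupOfForm σ J) V) (hρ : ρ.IsSmooth) (h : Subsingleton ((borelTriple σ J hJ).restrict ρ).Coinvariants) :
    ρ.IsSupercuspidal := by
  haveI := h
  exact ρ.isSupercuspidal_of_subsingleton_coinvariants_of_cartan hρ (borelTriple σ J hJ)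
    (fun j => ((congruenceGL N q).comap (unitaryGroupOfForm σ J).subtype ⊓ (borelTriple σ J hJ).N).map (MulAut.conj (t ^ (-j))).toMonoidHom)
    (fun j => rayLevel_mono σ hJ hq1 hq1 t w ht hw j)
    (fun u hu => exists_mem_rayLevel σ hJ hq0 hq1 hq0 hq1 t w ht hw hu)
    (fun O hO => exists_rayLevel_subset σ hJ hq0 hq1 hq0 hq1 t w ht hw hO) (t : ↥(unitaryGroupOfForm σ J))
    (fun j u hu => conj_mem_rayLevel σ hJ t j hu)
    ((glInt N K).comap (unitaryGroupOfForm σ J).subtype) (isCompact_comap_glInt σ hσc) hcartan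

end RayTop

/-! ## §3 The quasi-split unitary group in two variables: the ray `a = d(ϖ, (σϖ)⁻¹)` -/

section Two

variable {K : Type*} [Field K] [ValuativeRel K] [TopologicalSpace K] [IsNonarchimedeanLocalField K]
  (σ : K →+* K) {J : Matrix (Fin 2) (Fin 2) K} (hJ : J = (StdForm.antidiagonal 2).over K)
  {V : Type*} [AddCommGroup V] [Module ℂ V]

/-- **HARISH-CHANDRA'S CRITERION ⇐ FOR `U(σ, Φ₂)(K)`, RAY PINNED BY ITS MATRIX** `ha : (a : matrix) = diagonal ![ϖ, (σ ϖ)⁻¹]` (`ϖ` any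
element with `0 < |ϖ| < 1` — a uniformiser at the call site — and `|σ x| = |x|`): smooth + `V_N = 0` + Cartan `U = ⋃_n K₀ aⁿ K₀ Z(U)` ⇒
supercuspidal.  The `N = 2` twin of ★ `isSupercuspidal_of_coinvariants_subsingleton_of_cartan_diagonal` (rank 3), via §2 with `w = (ϖ, (σϖ)⁻¹)`,
`|w₀ ∕ w₁| = |ϖ|·|σ ϖ| ≤ |ϖ|`. [cite: Casselman1995, Thm. 5.3.1] [cite: BernsteinZelevinsky1976, Thm. 3.21] [cite: HarishChandra1970, Part I §3] -/
theorem isSupercuspidal_of_coinvariants_subsingleton_of_cartan_diagonal_two (hσc : Continuous σ)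
    (hσv : ∀ x, valuation K (σ x) = valuation K x) {ϖ : K} (hϖ0 : ϖ ≠ 0) (hϖ1 : valuation K ϖ < 1) (a : ↥(unitaryGroupOfForm σ J))
    (ha : (((a : ↥(unitaryGroupOfForm σ J)) : GL (Fin 2) K) : Matrix (Fin 2) (Fin 2) K) = Matrix.diagonal ![ϖ, (σ ϖ)⁻¹])
    (hcartan : ∀ g : ↥(unitaryGroupOfForm σ J), ∃ k₁ ∈ (glInt 2 K).comap (unitaryGroupOfForm σ J).subtype,
      ∃ k₂ ∈ (glInt 2 K).comap (unitaryGroupOfForm σ J).subtype, ∃ n : ℕ, ∃ z ∈ Subgroup.center ↥(unitaryGroupOfForm σ J), g = k₁ * a ^ n * k₂ * z)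
    (ρ : Representation ℂ ↥(unitaryGroupOfForm σ J) V) (hρ : ρ.IsSmooth) (h : Subsingleton ((borelTriple σ J hJ).restrict ρ).Coinvariants) :
    ρ.IsSupercuspidal := by
  have hσϖ0 : σ ϖ ≠ 0 := (map_ne_zero σ).2 hϖ0
  obtain ⟨w, hw0, hw1⟩ : ∃ w : Fin 2 → Kˣ, (w 0 : K) = ϖ ∧ (w 1 : K) = (σ ϖ)⁻¹ :=
    ⟨![Units.mk0 ϖ hϖ0, (Units.mk0 (σ ϖ) hσϖ0)⁻¹], rfl, by simp⟩
  have ht : ((a : ↥(unitaryGroupOfForm σ J)) : GL (Fin 2) K) = glDiagonal 2 K w := by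
    refine Units.ext ?_
    rw [ha, coe_glDiagonal]
    congr 1
    funext i
    fin_cases i
    · exact hw0.symm
    · exact hw1.symm
  have hw : ∀ i j : Fin 2, i < j → valuation K ((w i : K) * ((w j : K))⁻¹) ≤ valuation K ϖ := by
    intro i j hij
    fin_cases i <;> fin_cases j
    all_goals first | exact absurd hij (by decide) | skip
    show valuation K ((w 0 : K) * ((w 1 : K))⁻¹) ≤ valuation K ϖ
    rw [hw0, hw1, inv_inv, map_mul, hσv]
    exact le_trans (mul_le_mul' le_rfl hϖ1.le) (mul_one _).le
  exact isSupercuspidal_of_coinvariants_subsingleton_of_rayCartan σ hJ hσc ((Valuation.ne_zero_iff _).2 hϖ0) hϖ1 a w ht hw hcartan ρ hρ h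

end Two

end AnyRank

end UnitaryGroup

end Literature.NumberTheory.Automorphic
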